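import Summits.BirchSwinnertonDyer.Rank1Residual.X2.KeyCongruenceInvariants
import Summits.BirchSwinnertonDyer.BirchSwinnertonDyer.Theorems.SignedBaseChangeEisensteinSqueeze
import HarnessLib

/-!
# Route `SignedLowerHalves`, crux `KobayashiMainConjectureSmallImage` (item stmt-BirchSwinnertonDyer-19002):
# the `μ`-PINNING of a four-factor product divisibility in `Λ = ℤ_p⟦T⟧` — how the two-variable descent
# yields the integral Eisenstein half at SMALL image, where Kato's bound is only rational (cell `bsd-ssimc`,
# seat `bsd-line-slh-p3` gen 5, line `birth`; THEOREMS ONLY — pure algebra; helper file `--supports` item 4)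

PARTITION (cell bsd-ssimc): X7 (A7) × item 4 — types the last step of the designed line «acns»
(`Cruxes/KobayashiMainConjectureSmallImage/AcnsSketch.lean`); closes none; crux 4 OPEN. BSD is not
proved by any of this.

## The algebra

The `SignedBaseChange` descent (K2R⁗, `…SignedBaseChangeK2RAssembly.signedLowerDescent_of_prop422_of_package`)
ends with a product divisibility `L₁L₂L₃L₄ ∣ g₁g₂g₃g₄` in `Λ` (Pollack/Kobayashi `L^ε` of the four
`ℚ`-curves `E, E^{(D_K)}, E^{(d)}, E^{(dD_K)}`; generators `gᵢ` of their signed characteristic ideals) and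
SQUEEZES it with Kobayashi Thm. 4.1 in its INTEGRAL form `gᵢ ∣ Lᵢ` — available only for SURJECTIVE
`ρ̄_{E,p}` (`EisensteinSqueeze.associated_of_dvd_of_mul4_dvd`: `g₁ ~ L₁`). On item 4's domain (`ρ̄` not onto)
Thm. 4.1 gives only the RATIONAL form `gᵢ ∣ p^{nᵢ} Lᵢ` (`thm41_signedCharIdeal_divisibility.exists_dvd_pow_mul`).
This file records what the same product divisibility then yields, granted the ANALYTIC `μ`-vanishing
`μ(Lᵢ) = 0` (Pollack's Conjecture 6.3 / Perrin-Riou for the four curves, a per-pair computation):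

* `pfree_dvd_of_dvd_C_pow_mul` — a rational Kato bound `g ∣ pⁿ L` already gives `pfree g ∣ L` for the
  `p`-free part `pfree g = g / p^{μ(g)}` (`X1.MuLambda`);
* `dvd_of_mul4_dvd_of_dvd_C_pow_mul_of_mu_eq_zero` — **`L₁L₂L₃L₄ ∣ g₁g₂g₃g₄`, `gᵢ ∣ p^{nᵢ} Lᵢ` and
  `μ(Lᵢ) = 0` (all `i`) ⟹ `L₁ ∣ g₁`** (indeed `pfree g₁ ~ L₁`): the EISENSTEIN HALF for the first curve,
  INTEGRALLY; `…_all` — the same for all four factors.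

So at small image the descent delivers `KobayashiLowerDivisibility` (the registered stub
`stub_lowerSmallImage` of line `birth`, via `MuSplit.kobayashiLowerDivisibility_of_dvd_C_pow_mul_of_mu_eq_zero`)
but NOT the equality: `μ(g₁)` stays free (that is the registered `stub_saturationSmallImage`). Used by the
companion file `…SmallImageAcnsDescent.lean`.

References: [GreenbergVatsal2000] p. 2–4 ((1)–(2), `μ`); [Washington1997] §7.1; [Kobayashi2003] Thm. 4.1;
[Pollack2003] Conj. 6.3 (p. 548); [BurungaleSkinnerTianWan2024] §2.3 (the four-curve squeeze, at surjective image).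
-/

set_option autoImplicit false
set_option linter.dupNamespace false

noncomputable section

open scoped Classical

open Literature.NumberTheory.EllipticCurves Summit.BirchSwinnertonDyer.Rank1Residual
  Summit.BirchSwinnertonDyer.Rank1Residual.X1 Summit.BirchSwinnertonDyer.Rank1Residual.X1.MuLambda

namespace Summit.BirchSwinnertonDyer.BirchSwinnertonDyer.Theorems.SmallImageMuPinning

variable {p : ℕ} [Fact p.Prime]

/-- The `p`-free part has `μ = 0`. [cite: GreenbergVatsal2000, p. 2, (2)] -/
theorem mu_pfree (g : IwasawaAlgebra p) (hg : g ≠ 0) : mu (pfree g) = 0 :=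
  (mu_eq_and_pfree_eq (g := pfree g) (a := 0) (red_pfree_ne_zero hg)
    (by rw [pow_zero, map_one, one_mul])).1

/-- **A rational Kato bound pins the `p`-free part.** If `g ∣ pⁿ · L` in `Λ` with `L ≠ 0` then
`pfree g ∣ L` (`pfree g ∣ g`, and a divisibility `x ∣ pⁿ L` with `μ(x) ≤ μ(L)` is `x ∣ L`,
`X2.KeyCongruence.dvd_of_dvd_C_pow_mul_of_mu_le`). [cite: GreenbergVatsal2000, p. 4 (after Thm. (1.2))]
[cite: Washington1997, §7.1] -/
theorem pfree_dvd_of_dvd_C_pow_mul {g L : IwasawaAlgebra p} (hg : g ≠ 0) (hL : L ≠ 0) {n : ℕ}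
    (h : g ∣ PowerSeries.C (p : ℤ_[p]) ^ n * L) : pfree g ∣ L := by
  have h1 : pfree g ∣ g := ⟨PowerSeries.C ((p : ℤ_[p]) ^ mu g), by
    conv_lhs => rw [eq_C_pow_mu_mul_pfree g]
    ring⟩
  exact X2.KeyCongruence.dvd_of_dvd_C_pow_mul_of_mu_le hL n (h1.trans h)
    (by rw [mu_pfree g hg]; exact Nat.zero_le _)

/-- `μ` of a product of four non-zero elements. [cite: GreenbergVatsal2000, p. 2, (2)] -/
theorem mu_mul4 {a b c d : IwasawaAlgebra p} (ha : a ≠ 0) (hb : b ≠ 0) (hc : c ≠ 0) (hd : d ≠ 0) :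
    mu (a * b * c * d) = mu a + mu b + mu c + mu d := by
  rw [mu_mul (mul_ne_zero (mul_ne_zero ha hb) hc) hd, mu_mul (mul_ne_zero ha hb) hc, mu_mul ha hb]

/-- The product of four elements splits off `p^{Σ μ}` times the product of the `p`-free parts.
[cite: GreenbergVatsal2000, p. 2, (2)] -/
theorem mul4_eq_C_pow_mul_pfree (a b c d : IwasawaAlgebra p) :
    a * b * c * d = PowerSeries.C (p : ℤ_[p]) ^ (mu a + mu b + mu c + mu d) *
      (pfree a * pfree b * pfree c * pfree d) := by
  conv_lhs => rw [eq_C_pow_mu_mul_pfree a, eq_C_pow_mu_mul_pfree b, eq_C_pow_mu_mul_pfree c,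
    eq_C_pow_mu_mul_pfree d]
  rw [C_pow_eq, C_pow_eq, C_pow_eq, C_pow_eq]
  ring

/-- **The `μ`-pinning of the four-curve squeeze (first factor).** In `Λ = ℤ_p⟦T⟧`: if
`L₁L₂L₃L₄ ∣ g₁g₂g₃g₄` (the Eisenstein product divisibility), `gᵢ ∣ p^{nᵢ} Lᵢ` for each `i` (the
RATIONAL Kato bounds) and `μ(Lᵢ) = 0` for each `i` (analytic `μ`-vanishing), all `gᵢ, Lᵢ ≠ 0`, then
`pfree g₁ ~ L₁`, in particular **`L₁ ∣ g₁`** — the integral Eisenstein half for the first factor. (`μ(g₁)`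
is NOT pinned: `g₁ = p^{μ(g₁)} · u · L₁`.) [cite: GreenbergVatsal2000, p. 4] [cite: Washington1997, §7.1] -/
theorem dvd_of_mul4_dvd_of_dvd_C_pow_mul_of_mu_eq_zero
    {g₁ g₂ g₃ g₄ L₁ L₂ L₃ L₄ : IwasawaAlgebra p} {n₁ n₂ n₃ n₄ : ℕ}
    (hg₁ : g₁ ≠ 0) (hg₂ : g₂ ≠ 0) (hg₃ : g₃ ≠ 0) (hg₄ : g₄ ≠ 0)
    (hL₁ : L₁ ≠ 0) (hL₂ : L₂ ≠ 0) (hL₃ : L₃ ≠ 0) (hL₄ : L₄ ≠ 0)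
    (h₁ : g₁ ∣ PowerSeries.C (p : ℤ_[p]) ^ n₁ * L₁) (h₂ : g₂ ∣ PowerSeries.C (p : ℤ_[p]) ^ n₂ * L₂)
    (h₃ : g₃ ∣ PowerSeries.C (p : ℤ_[p]) ^ n₃ * L₃) (h₄ : g₄ ∣ PowerSeries.C (p : ℤ_[p]) ^ n₄ * L₄)
    (hμ₁ : mu L₁ = 0) (hμ₂ : mu L₂ = 0) (hμ₃ : mu L₃ = 0) (hμ₄ : mu L₄ = 0)
    (hprod : L₁ * L₂ * L₃ * L₄ ∣ g₁ * g₂ * g₃ * g₄) :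
    Associated (pfree g₁) L₁ ∧ L₁ ∣ g₁ := by
  -- the `p`-free parts divide the `L`'s
  have k₁ := pfree_dvd_of_dvd_C_pow_mul hg₁ hL₁ h₁
  have k₂ := pfree_dvd_of_dvd_C_pow_mul hg₂ hL₂ h₂
  have k₃ := pfree_dvd_of_dvd_C_pow_mul hg₃ hL₃ h₃
  have k₄ := pfree_dvd_of_dvd_C_pow_mul hg₄ hL₄ h₄
  -- the product of the `L`'s (`μ = 0`) divides the product of the `p`-free parts
  have hP0 : pfree g₁ * pfree g₂ * pfree g₃ * pfree g₄ ≠ 0 :=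
    mul_ne_zero (mul_ne_zero (mul_ne_zero (pfree_ne_zero hg₁) (pfree_ne_zero hg₂)) (pfree_ne_zero hg₃))
      (pfree_ne_zero hg₄)
  have hprod' : L₁ * L₂ * L₃ * L₄ ∣
      PowerSeries.C (p : ℤ_[p]) ^ (mu g₁ + mu g₂ + mu g₃ + mu g₄) *
        (pfree g₁ * pfree g₂ * pfree g₃ * pfree g₄) := by
    rw [← mul4_eq_C_pow_mul_pfree]; exact hprod
  have hμL : mu (L₁ * L₂ * L₃ * L₄) = 0 := by rw [mu_mul4 hL₁ hL₂ hL₃ hL₄, hμ₁, hμ₂, hμ₃, hμ₄]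
  have hLP : L₁ * L₂ * L₃ * L₄ ∣ pfree g₁ * pfree g₂ * pfree g₃ * pfree g₄ :=
    X2.KeyCongruence.dvd_of_dvd_C_pow_mul_of_mu_le hP0 _ hprod' (by rw [hμL]; exact Nat.zero_le _)
  -- four-factor squeeze in the domain `Λ`
  have hass : Associated (pfree g₁) L₁ :=
    SignedBaseChangeEisensteinSqueeze.associated_of_dvd_of_mul4_dvd k₁ k₂ k₃ k₄ hL₁ hL₂ hL₃ hL₄ hLP
  refine ⟨hass, hass.symm.dvd.trans ⟨PowerSeries.C ((p : ℤ_[p]) ^ mu g₁), ?_⟩⟩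
  conv_lhs => rw [eq_C_pow_mu_mul_pfree g₁]
  ring

/-- **The `μ`-pinning, all four factors**: under the hypotheses of
`dvd_of_mul4_dvd_of_dvd_C_pow_mul_of_mu_eq_zero`, `Lᵢ ∣ gᵢ` for `i = 1, 2, 3, 4` (the product hypothesis is
symmetric). [cite: GreenbergVatsal2000, p. 4] [cite: Washington1997, §7.1] -/
theorem dvd_of_mul4_dvd_of_dvd_C_pow_mul_of_mu_eq_zero_all
    {g₁ g₂ g₃ g₄ L₁ L₂ L₃ L₄ : IwasawaAlgebra p} {n₁ n₂ n₃ n₄ : ℕ}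
    (hg₁ : g₁ ≠ 0) (hg₂ : g₂ ≠ 0) (hg₃ : g₃ ≠ 0) (hg₄ : g₄ ≠ 0)
    (hL₁ : L₁ ≠ 0) (hL₂ : L₂ ≠ 0) (hL₃ : L₃ ≠ 0) (hL₄ : L₄ ≠ 0)
    (h₁ : g₁ ∣ PowerSeries.C (p : ℤ_[p]) ^ n₁ * L₁) (h₂ : g₂ ∣ PowerSeries.C (p : ℤ_[p]) ^ n₂ * L₂)
    (h₃ : g₃ ∣ PowerSeries.C (p : ℤ_[p]) ^ n₃ * L₃) (h₄ : g₄ ∣ PowerSeries.C (p : ℤ_[p]) ^ n₄ * L₄)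
    (hμ₁ : mu L₁ = 0) (hμ₂ : mu L₂ = 0) (hμ₃ : mu L₃ = 0) (hμ₄ : mu L₄ = 0)
    (hprod : L₁ * L₂ * L₃ * L₄ ∣ g₁ * g₂ * g₃ * g₄) :
    L₁ ∣ g₁ ∧ L₂ ∣ g₂ ∧ L₃ ∣ g₃ ∧ L₄ ∣ g₄ := by
  have e₂ : L₂ * L₁ * L₃ * L₄ ∣ g₂ * g₁ * g₃ * g₄ := by
    have hl : L₂ * L₁ * L₃ * L₄ = L₁ * L₂ * L₃ * L₄ := by ring
    have hr : g₂ * g₁ * g₃ * g₄ = g₁ * g₂ * g₃ * g₄ := by ring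
    rw [hl, hr]; exact hprod
  have e₃ : L₃ * L₂ * L₁ * L₄ ∣ g₃ * g₂ * g₁ * g₄ := by
    have hl : L₃ * L₂ * L₁ * L₄ = L₁ * L₂ * L₃ * L₄ := by ring
    have hr : g₃ * g₂ * g₁ * g₄ = g₁ * g₂ * g₃ * g₄ := by ring
    rw [hl, hr]; exact hprod
  have e₄ : L₄ * L₂ * L₃ * L₁ ∣ g₄ * g₂ * g₃ * g₁ := by
    have hl : L₄ * L₂ * L₃ * L₁ = L₁ * L₂ * L₃ * L₄ := by ring
    have hr : g₄ * g₂ * g₃ * g₁ = g₁ * g₂ * g₃ * g₄ := by ring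
    rw [hl, hr]; exact hprod
  exact ⟨(dvd_of_mul4_dvd_of_dvd_C_pow_mul_of_mu_eq_zero hg₁ hg₂ hg₃ hg₄ hL₁ hL₂ hL₃ hL₄ h₁ h₂ h₃ h₄
      hμ₁ hμ₂ hμ₃ hμ₄ hprod).2,
    (dvd_of_mul4_dvd_of_dvd_C_pow_mul_of_mu_eq_zero hg₂ hg₁ hg₃ hg₄ hL₂ hL₁ hL₃ hL₄ h₂ h₁ h₃ h₄
      hμ₂ hμ₁ hμ₃ hμ₄ e₂).2,
    (dvd_of_mul4_dvd_of_dvd_C_pow_mul_of_mu_eq_zero hg₃ hg₂ hg₁ hg₄ hL₃ hL₂ hL₁ hL₄ h₃ h₂ h₁ h₄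
      hμ₃ hμ₂ hμ₁ hμ₄ e₃).2,
    (dvd_of_mul4_dvd_of_dvd_C_pow_mul_of_mu_eq_zero hg₄ hg₂ hg₃ hg₁ hL₄ hL₂ hL₃ hL₁ h₄ h₂ h₃ h₁
      hμ₄ hμ₂ hμ₃ hμ₁ e₄).2⟩

/-- **Rational Kato in the `PowerSeries.C p` currency.** Kobayashi Thm. 4.1's rational form is spelled
`ξ ∣ (p : Λ) ^ n * L` (`thm41_signedCharIdeal_divisibility.exists_dvd_pow_mul`); the `μ`-algebra of
`X1.MuLambda` / `X2.KeyCongruence` uses `PowerSeries.C (p : ℤ_p) ^ n`. The two agree. [folklore] -/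
theorem natCast_pow_mul_eq_C_pow_mul (n : ℕ) (L : IwasawaAlgebra p) :
    (p : IwasawaAlgebra p) ^ n * L = PowerSeries.C (p : ℤ_[p]) ^ n * L := by
  rw [← map_natCast (PowerSeries.C (R := ℤ_[p])) p]

/-! ### §2 (appended). The SHARP form: the rational Eisenstein half needs NO `μ`-input, and the
integral one needs `μ = 0` for the FIRST factor only

Reading the four-factor squeeze once more: from `L₁L₂L₃L₄ ∣ g₁g₂g₃g₄` and the rational Kato bounds for the
OTHER three factors `gᵢ ∣ p^{nᵢ} Lᵢ` (`i = 2, 3, 4`) alone, cancelling `L₂L₃L₄ ≠ 0` gives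
`L₁ ∣ p^{n₂+n₃+n₄} · g₁` — the Eisenstein half for the first curve in `Λ ⊗ ℚ_p` (the «rational part» of
`KobayashiLowerDivisibility` in the μ-split `MuSplit.kobayashiLowerDivisibility_iff_dvd_C_pow_mul_and_mu_le`),
with NO `μ`-hypothesis at all; and then `μ(L₁) = 0` ALONE makes it integral. So on item 4's domain the
two-variable descent needs, beyond its two-variable inputs, exactly the ONE-SIGN analytic `μ`-rider of the
curve itself (`μ(L_p^ε(E)) = 0` for the sign at which the crux is concluded — idea card
`onesign-mu-cuspidal-generation`), not the `μ`'s of the auxiliary twists. -/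

/-- **The rational Eisenstein half from the product divisibility — no `μ`-input.** In a commutative domain
with a distinguished element `ϖ` (here `Λ = ℤ_p⟦T⟧`, `ϖ = C p`): `L₁L₂L₃L₄ ∣ g₁g₂g₃g₄` and `gᵢ ∣ ϖ^{nᵢ} Lᵢ` for
`i = 2, 3, 4` with `L₂, L₃, L₄ ≠ 0` give **`L₁ ∣ ϖ^{n₂+n₃+n₄} · g₁`**. [folklore] -/
theorem dvd_C_pow_mul_of_mul4_dvd {g₁ g₂ g₃ g₄ L₁ L₂ L₃ L₄ : IwasawaAlgebra p} {n₂ n₃ n₄ : ℕ}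
    (hL₂ : L₂ ≠ 0) (hL₃ : L₃ ≠ 0) (hL₄ : L₄ ≠ 0)
    (h₂ : g₂ ∣ PowerSeries.C (p : ℤ_[p]) ^ n₂ * L₂) (h₃ : g₃ ∣ PowerSeries.C (p : ℤ_[p]) ^ n₃ * L₃)
    (h₄ : g₄ ∣ PowerSeries.C (p : ℤ_[p]) ^ n₄ * L₄)
    (hprod : L₁ * L₂ * L₃ * L₄ ∣ g₁ * g₂ * g₃ * g₄) :
    L₁ ∣ PowerSeries.C (p : ℤ_[p]) ^ (n₂ + n₃ + n₄) * g₁ := by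
  obtain ⟨k₂, hk₂⟩ := h₂
  obtain ⟨k₃, hk₃⟩ := h₃
  obtain ⟨k₄, hk₄⟩ := h₄
  obtain ⟨m, hm⟩ := hprod
  have hL : L₂ * L₃ * L₄ ≠ 0 := mul_ne_zero (mul_ne_zero hL₂ hL₃) hL₄
  refine ⟨m * k₂ * k₃ * k₄, mul_right_cancel₀ hL ?_⟩
  calc PowerSeries.C (p : ℤ_[p]) ^ (n₂ + n₃ + n₄) * g₁ * (L₂ * L₃ * L₄)
      = g₁ * (PowerSeries.C (p : ℤ_[p]) ^ n₂ * L₂) * (PowerSeries.C (p : ℤ_[p]) ^ n₃ * L₃) *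
          (PowerSeries.C (p : ℤ_[p]) ^ n₄ * L₄) := by rw [pow_add, pow_add]; ring
    _ = (g₁ * g₂ * g₃ * g₄) * (k₂ * k₃ * k₄) := by rw [hk₂, hk₃, hk₄]; ring
    _ = L₁ * (m * k₂ * k₃ * k₄) * (L₂ * L₃ * L₄) := by rw [hm]; ring

/-- **Integral Eisenstein half from the product divisibility and ONE `μ`.** `L₁L₂L₃L₄ ∣ g₁g₂g₃g₄`,
`gᵢ ∣ p^{nᵢ} Lᵢ` (`i = 2, 3, 4`), `L₂, L₃, L₄ ≠ 0` and `μ(L₁) = 0` give **`L₁ ∣ g₁`**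
(`dvd_C_pow_mul_of_mul4_dvd` + `X2.KeyCongruence.dvd_of_dvd_C_pow_mul_of_mu_le`). The `μ`'s of
`L₂, L₃, L₄` and of the `gᵢ` play no role. [cite: GreenbergVatsal2000, p. 4] [cite: Washington1997, §7.1] -/
theorem dvd_of_mul4_dvd_of_mu_eq_zero {g₁ g₂ g₃ g₄ L₁ L₂ L₃ L₄ : IwasawaAlgebra p} {n₂ n₃ n₄ : ℕ}
    (hL₂ : L₂ ≠ 0) (hL₃ : L₃ ≠ 0) (hL₄ : L₄ ≠ 0)
    (h₂ : g₂ ∣ PowerSeries.C (p : ℤ_[p]) ^ n₂ * L₂) (h₃ : g₃ ∣ PowerSeries.C (p : ℤ_[p]) ^ n₃ * L₃)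
    (h₄ : g₄ ∣ PowerSeries.C (p : ℤ_[p]) ^ n₄ * L₄) (hμ₁ : mu L₁ = 0)
    (hprod : L₁ * L₂ * L₃ * L₄ ∣ g₁ * g₂ * g₃ * g₄) : L₁ ∣ g₁ := by
  have h := dvd_C_pow_mul_of_mul4_dvd hL₂ hL₃ hL₄ h₂ h₃ h₄ hprod
  by_cases hg₁ : g₁ = 0
  · rw [hg₁]; exact dvd_zero _
  · exact X2.KeyCongruence.dvd_of_dvd_C_pow_mul_of_mu_le hg₁ _ h (by rw [hμ₁]; exact Nat.zero_le _)

end Summit.BirchSwinnertonDyer.BirchSwinnertonDyer.Theorems.SmallImageMuPinning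

end
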